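import Summits.BirchSwinnertonDyer.BirchSwinnertonDyer.Theorems.GenusKolyvaginAtTwoGenusPrimitiveSupplyAtTwoPosDiscShallowSwapTypeReadsDepthBitKummer
import Summits.BirchSwinnertonDyer.BirchSwinnertonDyer.Theorems.GenusKolyvaginAtTwoGenusPrimitiveSupplyAtTwoPosDiscShallowSwapTypeReadsDepthBitPrimes
import HarnessLib

/-!
# Route `GenusKolyvaginAtTwo`, crux 25504 (K4Pos = stmt-BirchSwinnertonDyer-31469), positive depth: ON EVERY HABITAT K₄⁺/K₄ FRAME THERE ARE PRIMES,
# OUTSIDE ANY FINITE SET, WHOSE FROBENIUS IS OF TRANSPOSITION TYPE WITH NON-ZERO POSITIVE-DEPTH BIT — AND PRIMES WITH ZERO BIT (capstone of the swap-read files)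

Seat `bsd-line-gk2-p5` g35 (cell `bsd-f1-sign2`, WIDTH-5 attach), `--supports stmt-BirchSwinnertonDyer-31469 --as helper`.  THEOREMS ONLY; UNCONDITIONAL.
**BSD is NOT proved by this file, K4Pos is NOT claimed, no item is closed.**

Assembles p768152/p768681 (`SwapRead.exists_kummer_bit_ne_zero_of_habitat`, `…_eq_zero_of_habitat`: Galois elements of both bit values in the coset of a
transposition-type `σ`) with p768723 (`SwapRead.exists_isArithFrobAt_bit_eq`: Čebotarev transfers the bit and the `E[2]`-action of a Galois element to an
arithmetic Frobenius at a prime outside any finite set `S`):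

* **`exists_isArithFrobAt_transposition_bit_ne_zero_of_habitat`** — habitat frame (`W/ℚ` globally minimal, `ρ̄_{E,2^n}` onto; `K` imaginary quadratic,
  `d_K` odd, the two non-squares; `Q₀ ∉ 2E(K)`, `2w′ = e_*Q₀`, `σ•e_*Q₀ = −e_*Q₀ + e_*u₀`, `e_*u₀` of odd order; `σ` moves `u ∈ E[2]` with `σ²u = u`):
  for every finite `S` there are `v ∉ S`, `𝔓 ∣ v`, an arithmetic Frobenius `γ` at `𝔓` with the frame clauses (`γ•e_*Q₀ = −e_*Q₀ + e_*u₀`,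
  `γ•e_*u₀ = e_*u₀`), **`γ•u ≠ u`** (transposition type: the K₄⁺ clause) and **`bit(γ) ≠ 0`**.
* **`exists_isArithFrobAt_transposition_bit_eq_zero_of_habitat`** — the same with **`bit(γ) = 0`** (needs `σ²` trivial on `E[2]`).

READING.  Instrument I3⁺ («is `red_λ(y_K/2^{M₀})` `2`-divisible in `Ẽ(𝔽_{ℓ²})`?», p766882 §3) takes BOTH values on transposition-deep primes of
every habitat K₄⁺ frame, infinitely often (any finite `S` avoided).  Which value a K4Pos-WITNESS prime must show, and whether one exists with
`P(ℓ) ∉ 2E(K[ℓ])`, is the beyond-print content (Kolyvagin at `2`); nothing here decides it.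

References: [TateGCFT1967] §2.4; [GrossLMS1991] §3 (3.1)–(3.3), §4 (4.4), §6 Prop. 6.2, Prop. 9.1; [SilvermanAEC2009] VIII.§2, App. B.2.
-/

set_option autoImplicit false
set_option linter.dupNamespace false -- `Summit.<P>.<Sub>` repeats `BirchSwinnertonDyer` (D-0017)

noncomputable section

open scoped Classical NumberField Pointwise

namespace Summit.BirchSwinnertonDyer.BirchSwinnertonDyer.Theorems.GenusSupplyNarrow.SwapRead

open IsDedekindDomain Field WeierstrassCurve Literature.NumberTheory.EllipticCurves Literature.NumberTheory.GaloisRepresentations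

variable (W : WeierstrassCurve ℚ) [W.IsElliptic] [W.IsGloballyMinimal] {K : Type} [Field K] [NumberField K]
  (e : (W.baseChange K).toAffine.Point →+ W.geomPoints) (he : e = Affine.Point.map (W' := W) (absEmbedding ℚ K))

include he in
/-- **PRIMES WITH TRANSPOSITION-TYPE FROBENIUS AND NON-ZERO POSITIVE-DEPTH BIT EXIST ON EVERY HABITAT FRAME, OUTSIDE ANY FINITE SET.**  See the module
docstring for the frame (`hσt : σ•e_*u₀ = e_*u₀` is the frame clause of p767194 `frame_of_two_pow_smul`).  Proof: p768152 §5 gives `γ₀ ∈ {σ, σh}` (with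
`h` trivial on `E[2]` and on `e_*(E(K))`) of non-zero bit; `γ₀` still satisfies the frame clauses and moves `u`; p768723 §3 transfers bit, frame and
`E[2]`-action to an arithmetic Frobenius outside `S`. [cite: TateGCFT1967, §2.4] [cite: GrossLMS1991, Prop. 9.1, §6 Prop. 6.2] [cite: SilvermanAEC2009, VIII.§2] -/
theorem exists_isArithFrobAt_transposition_bit_ne_zero_of_habitat (hK : IsImaginaryQuadratic K) (hodd : Odd (NumberField.discr K))
    (hsq1 : ¬ IsSquare ((NumberField.discr K : ℚ) * -|W.Δ|)) (hsq2 : ¬ IsSquare ((NumberField.discr K : ℚ) * (-(2 * |W.Δ|))))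
    (hρ : ∀ n : ℕ, 0 < n → W.HasSurjectiveModNGaloisRep ((2 : ℤ) ^ n))
    {Q₀ u₀ : (W.baseChange K).toAffine.Point} (hQ₀ : ¬ ∃ R : (W.baseChange K).toAffine.Point, (2 : ℤ) • R = Q₀)
    {w' : W.geomPoints} (hw' : (2 : ℤ) • w' = e Q₀)
    (σ : absoluteGaloisGroup ℚ) (hσw : σ • e Q₀ = -e Q₀ + e u₀) (hσt : σ • e u₀ = e u₀) (hoddu : Odd (addOrderOf (e u₀)))
    {u : W.geomPoints} (hu2 : (2 : ℤ) • u = 0) (hu : σ • u ≠ u) (hσσu : σ • (σ • u) = u)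
    (S : Set (HeightOneSpectrum (𝓞 ℚ))) (hS : S.Finite) :
    ∃ (γ : absoluteGaloisGroup ℚ) (v : HeightOneSpectrum (𝓞 ℚ)) (𝔓 : Ideal (absIntegers (𝓞 ℚ) ℚ)),
      v ∉ S ∧ 𝔓 ∈ v.primesAbove ∧ IsArithFrobAt (𝓞 ℚ) γ 𝔓 ∧
      γ • e Q₀ = -e Q₀ + e u₀ ∧ γ • e u₀ = e u₀ ∧ γ • u ≠ u ∧
      γ • (γ • w' + w' - (((addOrderOf (e u₀) + 1) / 2 : ℕ) : ℤ) • e u₀) +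
        (γ • w' + w' - (((addOrderOf (e u₀) + 1) / 2 : ℕ) : ℤ) • e u₀) ≠ 0 := by
  obtain ⟨h, hfix, hfixK, -, hbits⟩ := exists_kummer_bit_ne_zero_of_habitat W e he hK hodd hsq1 hsq2 hρ hQ₀ hw' σ hσw hoddu hu2 hu hσσu
  -- the frame clauses and the `E[2]`-action of `σh` are those of `σ`
  have hσhw : (σ * h) • e Q₀ = -e Q₀ + e u₀ := by rw [mul_smul, hfixK, hσw]
  have hσht : (σ * h) • e u₀ = e u₀ := by rw [mul_smul, hfixK, hσt]
  have hσhu : (σ * h) • u ≠ u := by rw [mul_smul, hfix u hu2]; exact hu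
  rcases hbits with hb | hb
  · obtain ⟨γ, v, 𝔓, hvS, h𝔓, hγ, hw, ht, hγu, hbit⟩ := exists_isArithFrobAt_bit_eq W σ w' (e u₀) u S hS
    obtain ⟨hγw, hγt, hmove⟩ := frame_of_smul_eq W hw' hσw hσt hw ht hγu
    exact ⟨γ, v, 𝔓, hvS, h𝔓, hγ, hγw, hγt, hmove.mpr hu, by rw [hbit]; exact hb⟩
  · obtain ⟨γ, v, 𝔓, hvS, h𝔓, hγ, hw, ht, hγu, hbit⟩ := exists_isArithFrobAt_bit_eq W (σ * h) w' (e u₀) u S hS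
    obtain ⟨hγw, hγt, hmove⟩ := frame_of_smul_eq W hw' hσhw hσht hw ht hγu
    exact ⟨γ, v, 𝔓, hvS, h𝔓, hγ, hγw, hγt, hmove.mpr hσhu, by rw [hbit]; exact hb⟩

include he in
/-- **… AND PRIMES WITH TRANSPOSITION-TYPE FROBENIUS AND ZERO BIT** (same frame; `σ²` trivial on `E[2]`, as at every Zhang–Kolyvagin prime).
p768681 §6 gives `σh` of zero bit; Čebotarev transfers it. [cite: TateGCFT1967, §2.4] [cite: GrossLMS1991, Prop. 9.1, §6 Prop. 6.2] -/
theorem exists_isArithFrobAt_transposition_bit_eq_zero_of_habitat (hK : IsImaginaryQuadratic K) (hodd : Odd (NumberField.discr K))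
    (hsq1 : ¬ IsSquare ((NumberField.discr K : ℚ) * -|W.Δ|)) (hsq2 : ¬ IsSquare ((NumberField.discr K : ℚ) * (-(2 * |W.Δ|))))
    (hρ : ∀ n : ℕ, 0 < n → W.HasSurjectiveModNGaloisRep ((2 : ℤ) ^ n))
    {Q₀ u₀ : (W.baseChange K).toAffine.Point} (hQ₀ : ¬ ∃ R : (W.baseChange K).toAffine.Point, (2 : ℤ) • R = Q₀)
    {w' : W.geomPoints} (hw' : (2 : ℤ) • w' = e Q₀)
    (σ : absoluteGaloisGroup ℚ) (hσw : σ • e Q₀ = -e Q₀ + e u₀) (hσt : σ • e u₀ = e u₀) (hoddu : Odd (addOrderOf (e u₀)))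
    (hσσ : ∀ T : W.geomPoints, (2 : ℤ) • T = 0 → σ • (σ • T) = T) {u : W.geomPoints} (hu2 : (2 : ℤ) • u = 0) (hu : σ • u ≠ u)
    (S : Set (HeightOneSpectrum (𝓞 ℚ))) (hS : S.Finite) :
    ∃ (γ : absoluteGaloisGroup ℚ) (v : HeightOneSpectrum (𝓞 ℚ)) (𝔓 : Ideal (absIntegers (𝓞 ℚ) ℚ)),
      v ∉ S ∧ 𝔓 ∈ v.primesAbove ∧ IsArithFrobAt (𝓞 ℚ) γ 𝔓 ∧
      γ • e Q₀ = -e Q₀ + e u₀ ∧ γ • e u₀ = e u₀ ∧ γ • u ≠ u ∧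
      γ • (γ • w' + w' - (((addOrderOf (e u₀) + 1) / 2 : ℕ) : ℤ) • e u₀) +
        (γ • w' + w' - (((addOrderOf (e u₀) + 1) / 2 : ℕ) : ℤ) • e u₀) = 0 := by
  obtain ⟨h, hfix, hfixK, hb⟩ := exists_kummer_bit_eq_zero_of_habitat W e he hK hodd hsq1 hsq2 hρ hQ₀ hw' σ hσw hoddu hσσ
  have hσhw : (σ * h) • e Q₀ = -e Q₀ + e u₀ := by rw [mul_smul, hfixK, hσw]
  have hσht : (σ * h) • e u₀ = e u₀ := by rw [mul_smul, hfixK, hσt]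
  have hσhu : (σ * h) • u ≠ u := by rw [mul_smul, hfix u hu2]; exact hu
  obtain ⟨γ, v, 𝔓, hvS, h𝔓, hγ, hw, ht, hγu, hbit⟩ := exists_isArithFrobAt_bit_eq W (σ * h) w' (e u₀) u S hS
  obtain ⟨hγw, hγt, hmove⟩ := frame_of_smul_eq W hw' hσhw hσht hw ht hγu
  exact ⟨γ, v, 𝔓, hvS, h𝔓, hγ, hγw, hγt, hmove.mpr hσhu, by rw [hbit]; exact hb⟩

end Summit.BirchSwinnertonDyer.BirchSwinnertonDyer.Theorems.GenusSupplyNarrow.SwapRead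

end
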